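import Summits.QuantumFields.BalabanUV.Beta.FP.ConstrainedBiLaplacianStrip

/-!
# `BalabanUV.Beta.FP.ConstrainedBiLaplacianFibre` — road «FP» for binder row D1, row **RHOA-4-GH (localisation half)** as re-worded
# by R-FP-29: FILE 2a of 3 — THE SHERMAN–MORRISON STRUCTURE OF THE CONSTRAINED INVERSE OF `(Δ^ξ)^s` IN THE ALIAS FIBRE: the three
# Sherman–Morrison identities, the CONJUGATE block-averaging factors (`efc`, `vc`, `Fc`) as entire functions with `n`-uniform bounds,
# and the scalar coefficients `ainv`, `Spr` with the dictionary `den = U_0 + (Δ^ξ)^s·Spr` to FILE 1's zero-free denominator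

NOT IN PRINT; OUR PROOF ATTEMPT (binder row G-an2-4 ∕ (CONV-C), prover part P3, fibre∕strip lineage).  HONEST DEPENDENCY (cell records,
verbatim): «continuum YM on T⁴ ⇐ BetaPertH ∧ nine spine estimates (0/9 proved); BetaPertH ⇐ (D1) ∧ (D4) ∧ CAP+tail; G-an2-4 gates asym, D1
and NE2/3/4.»  HONEST FRAMING (cell contract, verbatim): «discharging `BetaPertH` makes Bałaban's UV stability UNCONDITIONAL — a real
constructive-QFT result; it is NOT the continuum limit and NOT the Clay problem.»  ABSOLUTE RULE (cell charter, verbatim): «No internally-minted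
statement may enter as a cited fact. Every hypothesis is either kernel-proved in this package or a verbatim quotation of a PUBLISHED theorem with
page reference. The manuscript(s) under audit are NOT citable for their own disputed steps — they are the thing under adjudication;
programme-internal (2001/route/tribunal) claims are never citable.»  THIS MODULE is [folklore] algebra and complex analysis over the momentum
symbols vendored by `B4Strip`∕`B4StripCauchy`∕`B4StripSums`∕`B5Strip145Analytic` ([B4] (2.45), (2.48)) and FILE 1
`FP/ConstrainedBiLaplacianStrip` (`den`); it re-defines no symbol, cites nothing as a hypothesis, has no `def … : Prop` and no `sorry`.

## The object (R-FP-29 (C) made explicit; every `d`, every `n ≥ 1`, every order `s`)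

In the ALIAS fibre over the coarse momentum `p′` the block averaging is rank one, `Q′*Q′ = |u⟩⟨ũ|` with `u_k = Π_ν v_n(k_ν; p′_ν)` (B4StripSums'
entire factor `v`, [B4] (2.45)) and `ũ_k` its complex conjugate (for real `p′`), and `A = (Δ^ξ)^s` is diagonal, `A_k = (Δ^ξ(p′+2πk))^s`
(`s = 2`: the ghost's constrained bi-Laplacian; `s = 1`: the constrained Laplacian).  The inverse of `A` compressed to `ker Q′`,
`= lim_{a→∞}(A + aQ′*Q′)⁻¹`, is `𝒢 = A⁻¹ − A⁻¹|u⟩⟨ũ|A⁻¹ ∕ ⟨ũ, A⁻¹u⟩` (Sherman–Morrison): §0 proves, over any field, `⟨ũ|𝒢 = 0`, `𝒢|u⟩ = 0`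
and `𝒢A = 1` on `ker ⟨ũ|` for this formula — i.e. `𝒢` IS that compressed inverse.  Its ENTRIES, regrouped through FILE 1's zero-free `den`, are
FILE 2b `FP/ConstrainedBiLaplacianFibreEntries` (`Gfib`); this file supplies their ingredients.

## Contents

* §0 `smG`, `shermanMorrison_mulVec_u` (`𝒢|u⟩ = 0`), `shermanMorrison_vecMul_ut` (`⟨ũ|𝒢 = 0`), `shermanMorrison_mulVec_A_of_ker` (`𝒢A = 1` on
  `ker ⟨ũ|`) — `G_{ij} = δ_{ij}∕A_i − u_i ũ_j∕(A_i A_j S)`, `S = Σ ũ_i u_i∕A_i`, all `A_i ≠ 0` (and `S ≠ 0` for the first two).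
* §1 the CONJUGATE one-coordinate factors: `efc n j t z = e^{−i(z+2πj)t∕n}` (`= (ef n j t z)⁻¹`, `norm_efc_le` `≤ 2` on `|Im z| ≤ 1∕2`,
  `efc_add_two_pi`, entire) and **`vc n j z := n⁻¹ Σ_{t<n} ef n j t z`** — a trigonometric polynomial with **`vc_eq_conj : vc n j z = conj (v n j (conj z))`**
  (Schwarz reflection; `vc_ofReal`: on real momenta the honest conjugate of [B4]'s factor), `norm_vc_le` (`≤ 12∕ω_n(j)` on the fat box, from
  `B4StripSums.norm_v_le`), `vc_add_two_pi`, `differentiable_vc`.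
* §2 the conjugate numerator **`Fc n σ k p = Π_ν efc·vc`** (partner of `B4StripSums.F = Π_ν ef·v`): `norm_Fc_le` (`≤ Π_ν 24∕ω_n(k_ν)` on the fat
  region), `differentiableAt_Fc` (entire, jointly), `Fc_tr` (relabelling under `2π`-shifts by `sigma`).
* §3 `ainv n s k p = ((Δ^ξ(p′+2πk))^s)⁻¹` (`k ≠ 0`: `norm_ainv_le` `≤ ((64∕7)∕W_k)^s`, `norm_ainv_le'` `≤ (64∕7)^s`, `differentiableAt_ainv` on the
  fat region), `Spr n s p = Σ_{k≠0} U_k·ainv_k` (`norm_Spr_le` `≤ 132^d(64∕7)^s`, `differentiableAt_Spr`), and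
  **`den_eq_U_add_mul_Spr : den n s p = U_0 + (Δ^ξ)^s·Spr n s p`**.

0∕4 row-D1 binders touched.  NOT RHOA-4-GH, NOT hbook, NOT D1, NOT BetaPertH, NOT continuum, NOT Clay.  Provenance: prover-b2b-balaban-gan24-p3-g21-0
(unit `b2b-balaban-gan24-p3`, gen 21; R-FP-29 first refusal), 2026-08-21.
-/

noncomputable section

namespace Summit.QuantumFields.BalabanUV.Beta.FP.ConstrainedBiLaplacianFibre

open Complex Finset ComplexConjugate
open Literature.MathematicalPhysics.QuantumFieldTheory.Balaban1983to89
open Literature.MathematicalPhysics.QuantumFieldTheory.Balaban1983to89.B4Strip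
open Literature.MathematicalPhysics.QuantumFieldTheory.Balaban1983to89.B4StripCauchy
open Literature.MathematicalPhysics.QuantumFieldTheory.Balaban1983to89.B5Strip145Analytic
open Literature.MathematicalPhysics.QuantumFieldTheory.Balaban1983to89.B4StripSums
open Summit.QuantumFields.BalabanUV.Beta.FP.ConstrainedBiLaplacianStrip
open scoped Real

variable {d : ℕ}

/-! ## §0 The Sherman–Morrison identities over a field -/

section ShermanMorrison

variable {ι K : Type*} [Fintype ι] [DecidableEq ι] [Field K]

/-- [folklore] The Sherman–Morrison entries of the inverse of a diagonal `A` compressed to the kernel of `⟨ũ|`: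
`smG A u ũ i j = δ_{ij}∕A_i − u_i ũ_j∕(A_i A_j S)`, `S = Σ_i ũ_i u_i∕A_i`. -/
def smG (A u ut : ι → K) (i j : ι) : K :=
  (if i = j then (A i)⁻¹ else 0) - u i * ut j / (A i * A j * ∑ l, ut l * u l / A l)

/-- [folklore] `𝒢|u⟩ = 0`: `Σ_j smG_{ij} u_j = 0` (all `A_i ≠ 0`, `S ≠ 0`). -/
theorem shermanMorrison_mulVec_u (A u ut : ι → K) (hA : ∀ i, A i ≠ 0) (hS : ∑ l, ut l * u l / A l ≠ 0) (i : ι) :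
    ∑ j, smG A u ut i j * u j = 0 := by
  unfold smG
  simp only [sub_mul, Finset.sum_sub_distrib, ite_mul, zero_mul, Finset.sum_ite_eq, Finset.mem_univ, if_true]
  have e : ∑ j, u i * ut j / (A i * A j * ∑ l, ut l * u l / A l) * u j
      = u i / (A i * ∑ l, ut l * u l / A l) * ∑ j, ut j * u j / A j := by
    rw [Finset.mul_sum]
    refine Finset.sum_congr rfl fun j _ => ?_
    have := hA j
    field_simp
  rw [e]
  have := hA i
  field_simp
  ring

/-- [folklore] `⟨ũ|𝒢 = 0`: `Σ_i ũ_i smG_{ij} = 0`. -/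
theorem shermanMorrison_vecMul_ut (A u ut : ι → K) (hA : ∀ i, A i ≠ 0) (hS : ∑ l, ut l * u l / A l ≠ 0) (j : ι) :
    ∑ i, ut i * smG A u ut i j = 0 := by
  unfold smG
  simp only [mul_sub, Finset.sum_sub_distrib, mul_ite, mul_zero, Finset.sum_ite_eq', Finset.mem_univ, if_true]
  have e : ∑ i, ut i * (u i * ut j / (A i * A j * ∑ l, ut l * u l / A l))
      = ut j / (A j * ∑ l, ut l * u l / A l) * ∑ i, ut i * u i / A i := by
    rw [Finset.mul_sum]
    refine Finset.sum_congr rfl fun i _ => ?_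
    have := hA i
    field_simp
  rw [e]
  have := hA j
  field_simp
  ring

/-- [folklore] `𝒢 A = 1` ON THE KERNEL OF `⟨ũ|`: for `x` with `Σ_j ũ_j x_j = 0`, `Σ_j smG_{ij} A_j x_j = x_i`. -/
theorem shermanMorrison_mulVec_A_of_ker (A u ut : ι → K) (hA : ∀ i, A i ≠ 0) (x : ι → K) (hx : ∑ j, ut j * x j = 0) (i : ι) :
    ∑ j, smG A u ut i j * (A j * x j) = x i := by
  unfold smG
  simp only [sub_mul, Finset.sum_sub_distrib, ite_mul, zero_mul, Finset.sum_ite_eq, Finset.mem_univ, if_true]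
  have e : ∑ j, u i * ut j / (A i * A j * ∑ l, ut l * u l / A l) * (A j * x j)
      = u i / (A i * ∑ l, ut l * u l / A l) * ∑ j, ut j * x j := by
    rw [Finset.mul_sum]
    refine Finset.sum_congr rfl fun j _ => ?_
    have := hA j
    field_simp
  rw [e, hx, mul_zero, sub_zero, inv_mul_cancel_left₀ (hA i)]

end ShermanMorrison

/-! ## §1 The conjugate one-coordinate factors -/

/-- [folklore] The CONJUGATE sub-lattice phase `efc n j t z = e^{−i(z+2πj)t∕n}` (`= (ef n j t z)⁻¹`; for real `z` the complex conjugate of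
`ef`). -/
def efc (n j t : ℕ) (z : ℂ) : ℂ := cexp (-(I * (z + 2 * π * j) * t / n))

/-- [folklore] `efc = ef⁻¹`. -/
theorem efc_eq_inv (n j t : ℕ) (z : ℂ) : efc n j t z = (ef n j t z)⁻¹ := by
  unfold efc ef
  rw [Complex.exp_neg]

/-- [folklore] `|efc| ≤ 2` on `|Im z| ≤ 1∕2` for `t ≤ n`. -/
theorem norm_efc_le (n j t : ℕ) (htn : t ≤ n) {z : ℂ} (hy : |z.im| ≤ 1 / 2) : ‖efc n j t z‖ ≤ 2 := by
  unfold efc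
  rw [Complex.norm_exp]
  refine (exp_lt_two ?_).le
  have hre : (-(I * (z + 2 * π * j) * t / n)).re = z.im * t / n := by
    simp [Complex.mul_re, Complex.mul_im, mul_div_assoc]
  rw [hre]
  rcases Nat.eq_zero_or_pos n with h0 | hpos
  · subst h0; simp
  · have hnr : (0 : ℝ) < n := by exact_mod_cast hpos
    have ht : (t : ℝ) / n ≤ 1 := by
      rw [div_le_one hnr]; exact_mod_cast htn
    have ht0 : 0 ≤ (t : ℝ) / n := by positivity
    have : z.im * t / n = z.im * (t / n) := by ring
    rw [this]
    have hzi : z.im ≤ 1 / 2 := (le_abs_self _).trans hy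
    nlinarith

/-- [folklore] The conjugate phase is `2π`-periodic up to the residue shift `j ↦ j+1 (mod n)`. -/
theorem efc_add_two_pi (n j t : ℕ) (hn : n ≠ 0) (z : ℂ) : efc n j t (z + 2 * π) = efc n ((j + 1) % n) t z := by
  rw [efc_eq_inv, efc_eq_inv, ef_add_two_pi n j t hn z]

/-- [folklore] The conjugate phase is entire. -/
theorem differentiable_efc (n j t : ℕ) : Differentiable ℂ (efc n j t) := by
  unfold efc; fun_prop

/-- [folklore] **THE CONJUGATE BLOCK-AVERAGING FACTOR** `vc n j z := n⁻¹ Σ_{t<n} e^{i(z+2πj)t∕n}` — a trigonometric polynomial (entire), equal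
to `conj (v n j (conj z))` (`vc_eq_conj`): the holomorphic continuation of the complex conjugate of [B4]'s one-coordinate factor of
`u_j(p′+l)` off the real momenta. -/
def vc (n j : ℕ) (z : ℂ) : ℂ := (n : ℂ)⁻¹ * ∑ t ∈ Finset.range n, ef n j t z

/-- [folklore] `ef n j t z = (e^{i(z+2πj)∕n})^t`. -/
theorem ef_eq_pow (n j t : ℕ) (z : ℂ) : ef n j t z = cexp (I * (z + 2 * π * j) / n) ^ t := by
  unfold ef
  rw [← Complex.exp_nat_mul]
  congr 1
  ring

/-- [folklore] `conj (w n j (conj z)) = e^{i(z+2πj)∕n}`. -/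
theorem conj_w_conj (n j : ℕ) (z : ℂ) : conj (w n j (conj z)) = cexp (I * (z + 2 * π * j) / n) := by
  unfold w
  rw [← Complex.exp_conj]
  congr 1
  simp only [map_neg, map_div₀, map_mul, Complex.conj_I, map_add, Complex.conj_conj, map_natCast, map_ofNat,
    Complex.conj_ofReal]
  ring

/-- [folklore] **SCHWARZ REFLECTION**: `vc n j z = conj (v n j (conj z))`. -/
theorem vc_eq_conj (n j : ℕ) (z : ℂ) : vc n j z = conj (v n j (conj z)) := by
  unfold vc v
  rw [map_mul, map_inv₀, map_natCast, map_sum]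
  congr 1
  refine Finset.sum_congr rfl fun t _ => ?_
  rw [map_pow, conj_w_conj, ef_eq_pow]

/-- [folklore] For REAL `x`: `vc n j x = conj (v n j x)` (the honest complex conjugate on the real momenta). -/
theorem vc_ofReal (n j : ℕ) (x : ℝ) : vc n j x = conj (v n j x) := by
  rw [vc_eq_conj, Complex.conj_ofReal]

/-- [folklore] **ONE-COORDINATE MODULUS BOUND** `|vc n j z| ≤ 12∕ω_n(j)` on the fat box `|Re z| ≤ π + r`, `|Im z| ≤ 2r` (`r ≤ 1∕4`), uniformly
in `n ≥ 1` (`B4StripSums.norm_v_le` at `conj z`). -/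
theorem norm_vc_le (n : ℕ) [NeZero n] (j : Fin n) {z : ℂ} {r : ℝ} (hr : r ≤ 1 / 4) (hx : |z.re| ≤ π + r)
    (hy : |z.im| ≤ 2 * r) : ‖vc n j z‖ ≤ 12 / omega n j := by
  rw [vc_eq_conj, Complex.norm_conj]
  refine norm_v_le n j hr ?_ ?_
  · rw [Complex.conj_re]; exact hx
  · rw [Complex.conj_im, abs_neg]; exact hy

/-- [folklore] `vc` is `2π`-periodic up to the residue shift. -/
theorem vc_add_two_pi (n j : ℕ) (hn : n ≠ 0) (z : ℂ) : vc n j (z + 2 * π) = vc n ((j + 1) % n) z := by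
  unfold vc
  congr 1
  exact Finset.sum_congr rfl fun t _ => ef_add_two_pi n j t hn z

/-- [folklore] `vc` is entire. -/
theorem differentiable_vc (n j : ℕ) : Differentiable ℂ (vc n j) := by
  unfold vc ef; fun_prop

/-! ## §2 The conjugate numerator `Fc` -/

/-- [folklore] **THE CONJUGATE NUMERATOR** `Fc n σ k p = Π_ν efc n k_ν σ_ν p_ν · vc n k_ν p_ν` — for real `p′` the complex conjugate of
`B4StripSums.F n σ k p′ = e^{i(p′+l)·ξσ} u(p′+l)`, i.e. `e^{−i(p′+l)·ξσ} ū(p′+l)`, continued as an entire function of `p′`. -/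
def Fc (n : ℕ) (σ k : Fin d → Fin n) (p : Fin d → ℂ) : ℂ :=
  ∏ ν, (efc n (k ν : ℕ) (σ ν : ℕ) (p ν) * vc n (k ν : ℕ) (p ν))

/-- [folklore] `|Fc n σ k p| ≤ Π_ν 24∕ω_n(k_ν)` on the fat region (`r ≤ 1∕4`). -/
theorem norm_Fc_le (n : ℕ) [NeZero n] {r : ℝ} (hr : r ≤ 1 / 4) (σ k : Fin d → Fin n) {p : Fin d → ℂ}
    (hp : p ∈ Fat d r) : ‖Fc n σ k p‖ ≤ ∏ ν, 24 / omega n (k ν) := by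
  unfold Fc
  rw [norm_prod]
  refine Finset.prod_le_prod (fun _ _ => norm_nonneg _) (fun ν _ => ?_)
  rw [norm_mul]
  have h1 := norm_efc_le n (k ν) (σ ν) (σ ν).isLt.le (z := p ν) (by linarith [(hp ν).2])
  have h2 := norm_vc_le n (k ν) hr (hp ν).1 (hp ν).2
  have hω := omega_pos n (k ν) (k ν).isLt
  calc ‖efc n (k ν) (σ ν) (p ν)‖ * ‖vc n (k ν) (p ν)‖ ≤ 2 * (12 / omega n (k ν)) :=
        mul_le_mul h1 h2 (norm_nonneg _) (by norm_num)
    _ = 24 / omega n (k ν) := by ring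

/-- [folklore] `Fc n σ k` is entire on `ℂ^d` (jointly). -/
theorem differentiableAt_Fc (n : ℕ) (σ k : Fin d → Fin n) (q : Fin d → ℂ) : DifferentiableAt ℂ (Fc n σ k) q := by
  unfold Fc
  apply dAt_finset_prod
  intro ν _
  have h1 : DifferentiableAt ℂ (fun p : Fin d → ℂ => efc n (k ν) (σ ν) (p ν)) q :=
    DifferentiableAt.comp (g := efc n (k ν) (σ ν)) (f := fun p : Fin d → ℂ => p ν) q
      ((differentiable_efc n (k ν) (σ ν)) (q ν)) (differentiableAt_apply (𝕜 := ℂ) ν q)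
  have h2 : DifferentiableAt ℂ (fun p : Fin d → ℂ => vc n (k ν) (p ν)) q :=
    DifferentiableAt.comp (g := vc n (k ν)) (f := fun p : Fin d → ℂ => p ν) q
      ((differentiable_vc n (k ν)) (q ν)) (differentiableAt_apply (𝕜 := ℂ) ν q)
  exact h1.mul h2

/-- [folklore] `Fc n σ k (p + 2π e_μ) = Fc n σ (σ_μ k) p`: the conjugate numerator relabels under `2π`-shifts (on all of `ℂ^d`). -/
theorem Fc_tr (n : ℕ) [NeZero n] (σ k : Fin d → Fin n) (p : Fin d → ℂ) (μ : Fin d) :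
    Fc n σ k (tr p μ) = Fc n σ (sigma n μ k) p := by
  unfold Fc
  refine Finset.prod_congr rfl (fun ν _ => ?_)
  by_cases h : ν = μ
  · subst h
    rw [tr_apply_self, sigma_apply_self, val_add_one_eq_mod, efc_add_two_pi _ _ _ (NeZero.ne n),
      vc_add_two_pi _ _ (NeZero.ne n)]
  · rw [tr_apply_of_ne h, sigma_apply_of_ne n h]

/-! ## §3 The scalar coefficients and the dictionary with `den` -/

/-- [folklore] `ainv n s k p = ((Δ^ξ(p′+2πk))^s)⁻¹` — the inverse shifted symbol power (used for `k ≠ 0`, where it is holomorphic and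
`n`-uniformly bounded on the fat region). -/
def ainv (n : ℕ) (s : ℕ) (k : Fin d → Fin n) (p : Fin d → ℂ) : ℂ := (DeltaXi n 0 (shift n k p) ^ s)⁻¹

/-- [folklore] `‖ainv n s k q‖ ≤ ((64∕7)∕W_n(k))^s` for `k ≠ 0` on the fat region (`B4StripSums.re_DeltaXi_shift_ge_W`). -/
theorem norm_ainv_le (n : ℕ) [NeZero n] (s : ℕ) {r : ℝ} (hr : r ≤ 1 / 4) (hdr : (d : ℝ) * r ^ 2 ≤ 1 / 16) {q : Fin d → ℂ}
    (hq : q ∈ Fat d r) (k : Fin d → Fin n) (hk : k ≠ fun _ => 0) : ‖ainv n s k q‖ ≤ ((64 / 7) / W n k) ^ s := by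
  unfold ainv
  have hW := one_le_W n k hk
  have hre := re_DeltaXi_shift_ge_W n 0 le_rfl hr hdr hq k hk
  have hpos : 0 < 7 / 64 * W n k := by linarith
  have hnorm : 7 / 64 * W n k ≤ ‖DeltaXi n 0 (shift n k q)‖ := hre.trans (Complex.re_le_norm _)
  rw [norm_inv, norm_pow]
  calc (‖DeltaXi n 0 (shift n k q)‖ ^ s)⁻¹ ≤ ((7 / 64 * W n k) ^ s)⁻¹ :=
        inv_anti₀ (pow_pos hpos s) (pow_le_pow_left₀ hpos.le hnorm s)
    _ = ((64 / 7) / W n k) ^ s := by rw [← inv_pow]; congr 1; field_simp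

/-- [folklore] The cruder `n`-uniform bound `‖ainv n s k q‖ ≤ (64∕7)^s` (`W ≥ 1`). -/
theorem norm_ainv_le' (n : ℕ) [NeZero n] (s : ℕ) {r : ℝ} (hr : r ≤ 1 / 4) (hdr : (d : ℝ) * r ^ 2 ≤ 1 / 16) {q : Fin d → ℂ}
    (hq : q ∈ Fat d r) (k : Fin d → Fin n) (hk : k ≠ fun _ => 0) : ‖ainv n s k q‖ ≤ (64 / 7) ^ s := by
  have hW := one_le_W n k hk
  refine (norm_ainv_le n s hr hdr hq k hk).trans (pow_le_pow_left₀ (by positivity) ?_ s)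
  rw [div_le_iff₀ (by linarith)]
  nlinarith

/-- [folklore] `ainv n s k` is holomorphic (jointly) on the fat region for `k ≠ 0`. -/
theorem differentiableAt_ainv (n : ℕ) [NeZero n] (s : ℕ) {r : ℝ} (hr : r ≤ 1 / 4) (hdr : (d : ℝ) * r ^ 2 ≤ 1 / 16)
    {q : Fin d → ℂ} (hq : q ∈ Fat d r) (k : Fin d → Fin n) (hk : k ≠ fun _ => 0) :
    DifferentiableAt ℂ (ainv n s k) q := by
  unfold ainv
  exact ((differentiableAt_DeltaXi_shift n 0 k q).pow s).inv (pow_ne_zero s (DeltaXi_shift_ne_zero n 0 le_rfl hr hdr hq k hk))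

/-- [folklore] `Spr n s p = Σ_{k≠0} U_k·ainv_k` — the REGULAR part `⟨ũ, A⁻¹u⟩ − U_0∕A_0` of the Sherman–Morrison denominator. -/
def Spr (n : ℕ) [NeZero n] (s : ℕ) (p : Fin d → ℂ) : ℂ :=
  ∑ k ∈ Finset.univ.erase (fun _ => (0 : Fin n)), U n k p * ainv n s k p

/-- [folklore] `‖Spr n s q‖ ≤ 132^d·(64∕7)^s` on the fat region (`B4StripCauchy.sum_norm_U_le`). -/
theorem norm_Spr_le (n : ℕ) [NeZero n] (s : ℕ) {r : ℝ} (hr : r ≤ 1 / 4) (hdr : (d : ℝ) * r ^ 2 ≤ 1 / 16) {q : Fin d → ℂ}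
    (hq : q ∈ Fat d r) : ‖Spr n s q‖ ≤ 132 ^ d * (64 / 7) ^ s := by
  unfold Spr
  calc ‖∑ k ∈ Finset.univ.erase (fun _ => (0 : Fin n)), U n k q * ainv n s k q‖
      ≤ ∑ k ∈ Finset.univ.erase (fun _ => (0 : Fin n)), ‖U n k q * ainv n s k q‖ := norm_sum_le _ _
    _ ≤ ∑ k ∈ Finset.univ.erase (fun _ => (0 : Fin n)), ‖U n k q‖ * (64 / 7) ^ s := by
        refine Finset.sum_le_sum fun k hk => ?_
        rw [norm_mul]
        exact mul_le_mul_of_nonneg_left (norm_ainv_le' n s hr hdr hq k (Finset.ne_of_mem_erase hk)) (norm_nonneg _)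
    _ ≤ ∑ k : Fin d → Fin n, ‖U n k q‖ * (64 / 7) ^ s :=
        Finset.sum_le_sum_of_subset_of_nonneg (Finset.erase_subset _ _) (fun _ _ _ => by positivity)
    _ = (∑ k : Fin d → Fin n, ‖U n k q‖) * (64 / 7) ^ s := by rw [Finset.sum_mul]
    _ ≤ 132 ^ d * (64 / 7) ^ s := mul_le_mul_of_nonneg_right (sum_norm_U_le n hr hq) (by positivity)

/-- [folklore] `Spr n s` is holomorphic (jointly) on the fat region. -/
theorem differentiableAt_Spr (n : ℕ) [NeZero n] (s : ℕ) {r : ℝ} (hr : r ≤ 1 / 4) (hdr : (d : ℝ) * r ^ 2 ≤ 1 / 16)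
    {q : Fin d → ℂ} (hq : q ∈ Fat d r) : DifferentiableAt ℂ (Spr n s) q := by
  show DifferentiableAt ℂ (fun p => ∑ k ∈ Finset.univ.erase (fun _ => (0 : Fin n)), U n k p * ainv n s k p) q
  apply DifferentiableAt.fun_sum
  intro k hk
  exact (differentiableAt_U n hr hq k).mul (differentiableAt_ainv n s hr hdr hq k (Finset.ne_of_mem_erase hk))

/-- [folklore] **DICTIONARY WITH FILE 1's DENOMINATOR**: `den n s p = U_0(p) + (Δ^ξ(p))^s · Spr n s p` (the `k = 0` term has `R_0 = 1`; for
`k ≠ 0`, `R_k^s = (Δ^ξ)^s·ainv_k`). -/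
theorem den_eq_U_add_mul_Spr (n : ℕ) [NeZero n] (s : ℕ) (p : Fin d → ℂ) :
    den n s p = U n (fun _ => (0 : Fin n)) p + DeltaXi n 0 p ^ s * Spr n s p := by
  unfold den Spr
  rw [← Finset.add_sum_erase Finset.univ (fun k => U n k p * R n 0 k p ^ s) (Finset.mem_univ (fun _ => (0 : Fin n)))]
  congr 1
  · unfold R
    rw [if_pos rfl, one_pow, mul_one]
  · rw [Finset.mul_sum]
    refine Finset.sum_congr rfl fun k hk => ?_
    unfold R ainv
    rw [if_neg (Finset.ne_of_mem_erase hk), div_pow, div_eq_mul_inv]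
    ring

end Summit.QuantumFields.BalabanUV.Beta.FP.ConstrainedBiLaplacianFibre

end
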